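import Summits.NavierStokesRegularity.OSWSelfSimilar.SheetRPerturbedResolventIdentityC
import HarnessLib

/-!
# SHEET-ℝ frame, (P1) for the FULL operator `A = (−∂² + d∂ + V) + K`: the scalar REAL solution operator `S_K(s) = (A + s)⁻¹ : L²_w → E`
# for real `s > −m` (cert-2's `A_F⁻¹` as one bundled map), its weak meaning, uniqueness, energy and pivot bounds, and its place in `R_K`

HONEST FRAMING (cell ns-blowup GROUP B / zone Z3, cases Z3-SR-CERT (MODEL ASSEMBLY, item (β) «the solution operator `S` of `DG(Ω̄)`») and
Z3-SR-SPEC (P1); 1-D MODEL certificate frame (viscous gCLM/OSW sheet on the line); not Euler/NS; «violates: none — MODEL»). Nothing here asserts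
that a profile exists; the Gårding datum of the perturbed form ((S1)/(C1), interval arithmetic) is the HYPOTHESIS `GardingDataKC`
(`‖v₁‖²_w`-coefficient `c > 0`); `K : Esp L hL →L[ℝ] W L` is an arbitrary bounded real operator (cert-1/cert-2: `K = −P (+ F)`).

The complex chain (`SheetRPerturbedResolventC`) delivers the pair solution operator `pairOpKC σ`; for REAL `σ = s` the pair system decouples and its
first component on real data `(g, 0)` is the real solution operator the assembly seats asked for (selfsim g11 HANDOFF, OWED (b)):

* `inlW L : W L →L[ℝ] WithLp 2 (W L × W L)`, `g ↦ (g, 0)` (`norm_inlW`, `ofPair_inlW : ofPair (g, 0) = ofRealW g`);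
* **`solOpKC hL K h s hs : W L →L[ℝ] Esp L hL`** (`−m < s`) — `g ↦ (pairOpKC s (g, 0)).fst`; `pairOpKC_inlW_snd` (the second component is `0`);
* `solOpKC_weak` — `linForm_{V+s}(u; v) + ∫ w (K S g) v = ∫ w g v` on every compactly supported odd energy-class test, `u = prim (der (S g))`;
* `solOpKC_unique` — an energy-space weak solution IS `S g`;
* `norm_solOpKC_le` — ENERGY bound `‖S g‖_E ≤ (4/κ_c(s))‖g‖_w`, `κ_c(s) = min(c, 4(m + s))` (`‖p‖²_E = ¼‖u‖²_w + ‖u₁‖²_w`);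
* `resolventKC_ofRealW` — `R_K(s)(g + 0·i) = ιE(S g) + 0·i`: on real data at real `s` the complex resolvent IS the real solution;
* `norm_ιE_solOpKC_le` — PIVOT bound `‖u‖_w ≤ ‖g‖_w/(m + s)` (from the sharp resolvent bound).
One bundled map (`inlW`) and one definition (`solOpKC`); no named fact.  WHAT THIS IS NOT: not NS; no number of record moves.
-/

noncomputable section

namespace Summit.NavierStokesRegularity.OSWSelfSimilar
namespace SheetRPerturbedSolutionOperator

open _root_.MeasureTheory _root_.Set _root_.Filter _root_.Real SheetRWeakProfilePV SheetRWeakToStrong SheetREnergyClass SheetRWeightedMeasure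
  SheetRLinearisedTests SheetREnergySpace SheetRTestSpace SheetRLinearisedFormBounds SheetRSolutionOperator SheetRLinearisedCutoffEnergy
  SheetRResolventPair SheetRComplexPivot SheetRResolventComplex SheetRResolventIdentity SheetRPerturbedUniqueness SheetRPerturbedPair
  SheetRPerturbedResolventC SheetRPerturbedResolventIdentityC Literature.Analysis.OperatorTheory
open scoped Topology ENNReal

variable {L D₀ D₁ V₀ c m : ℝ} {d V : ℝ → ℝ}

/-! ### §1 Real data as pairs -/

/-- A real shift `s > −m` as a complex shift. [folklore] -/
theorem re_ofReal_gt {s : ℝ} (hs : -m < s) : -m < (s : ℂ).re := by rwa [Complex.ofReal_re]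

variable (L) in
/-- `g ↦ (g, 0) ∈ WithLp 2 (L²_w × L²_w)`. [folklore] -/
def inlW : W L →L[ℝ] WithLp 2 (W L × W L) :=
  ((WithLp.prodContinuousLinearEquiv 2 ℝ (W L) (W L)).symm : (W L × W L) →L[ℝ] WithLp 2 (W L × W L)).comp (ContinuousLinearMap.inl ℝ (W L) (W L))

/-- Components of `inlW`. [folklore] -/
theorem inlW_fst_snd (g : W L) : (inlW L g).fst = g ∧ (inlW L g).snd = 0 := ⟨rfl, rfl⟩

/-- `‖(g, 0)‖ = ‖g‖`. [folklore] -/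
theorem norm_inlW (g : W L) : ‖inlW L g‖ = ‖g‖ := by
  have hsq : ‖inlW L g‖ ^ 2 = ‖g‖ ^ 2 := by
    rw [WithLp.prod_norm_sq_eq_of_L2, (inlW_fst_snd g).1, (inlW_fst_snd g).2, norm_zero, zero_pow two_ne_zero, add_zero]
  exact (pow_left_inj₀ (norm_nonneg _) (norm_nonneg _) two_ne_zero).1 hsq

/-- `ofPair (g, 0) = ofRealW g` and `toPair (ofRealW g) = (g, 0)`. [folklore] -/
theorem ofPair_inlW (g : W L) : ofPair L (inlW L g) = ofRealW L g ∧ toPair L (ofRealW L g) = inlW L g := by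
  have h1 : ofPair L (inlW L g) = ofRealW L g := by
    rw [ofPair_apply, (inlW_fst_snd g).1, (inlW_fst_snd g).2, map_zero, smul_zero, add_zero]
  exact ⟨h1, by rw [← h1, toPair_ofPair]⟩

/-- The weighted pairing of the zero class vanishes. [folklore] -/
theorem integral_weight_zeroW (hL : 0 < L) (v : ℝ → ℝ) : ∫ y, (L ^ 2 + y ^ 2) * (((0 : W L) : ℝ → ℝ) y * v y) = 0 := by
  have h0 : ((0 : W L) : ℝ → ℝ) =ᵐ[volume] (0 : ℝ → ℝ) := ae_volume_of_ae_μw hL (Lp.coeFn_zero ℝ 2 (μw L))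
  have : (fun y => (L ^ 2 + y ^ 2) * (((0 : W L) : ℝ → ℝ) y * v y)) =ᵐ[volume] fun _ => (0 : ℝ) := by
    filter_upwards [h0] with y hy
    rw [hy, Pi.zero_apply, zero_mul, mul_zero]
  rw [integral_congr_ae this, integral_zero]

/-- The scalar left-hand side at the zero profile vanishes. [folklore] -/
theorem scalar_lhs_zero (hL : 0 < L) (K : Esp L hL →L[ℝ] W L) (h : GardingDataKC L hL d V K D₀ D₁ V₀ c m) (s : ℝ) (v v₁ : ℝ → ℝ)
    (hv : IsCompactTest v v₁) :
    linForm L d (fun ξ => V ξ + s) (prim (der (0 : Esp L hL))) (der (0 : Esp L hL)) v v₁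
        + ∫ y, (L ^ 2 + y ^ 2) * (((K (0 : Esp L hL) : W L) : ℝ → ℝ) y * v y) = 0 := by
  have e1 := lhs_eqKC hL K h s 0 (0 : Esp L hL) (0 : Esp L hL) v v₁ hv
  have hR : Eform hL h.d_meas (shift_hypsKC h s).1 h.D₁_nonneg h.d_le (shift_hypsKC h s).2 (0 : Esp L hL) ⟨(v, v₁), hv⟩
      + Pdata hL (K (0 : Esp L hL)) ⟨(v, v₁), hv⟩ - 0 * Bcpl hL (0 : Esp L hL) ⟨(v, v₁), hv⟩ = 0 := by
    simp only [map_zero, LinearMap.zero_apply, zero_mul, add_zero, sub_zero]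
  have e := e1.trans hR
  rwa [zero_mul, sub_zero] at e

/-! ### §2 The real solution operator -/

/-- **The scalar real perturbed solution operator** `S_K(s) = (A + s)⁻¹ : L²_w → E` for `−m < s`: first component of `pairOpKC s (g, 0)`. [folklore] -/
def solOpKC (hL : 0 < L) (K : Esp L hL →L[ℝ] W L) (h : GardingDataKC L hL d V K D₀ D₁ V₀ c m) (s : ℝ) (hs : -m < s) : W L →L[ℝ] Esp L hL :=
  (WithLp.fstL 2 ℝ (Esp L hL) (Esp L hL)).comp ((pairOpKC hL K h (s : ℂ) (re_ofReal_gt hs)).comp (inlW L))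

/-- Unfolding `solOpKC`. [folklore] -/
theorem solOpKC_apply (hL : 0 < L) (K : Esp L hL →L[ℝ] W L) (h : GardingDataKC L hL d V K D₀ D₁ V₀ c m) {s : ℝ} (hs : -m < s) (g : W L) :
    solOpKC hL K h s hs g = (pairOpKC hL K h (s : ℂ) (re_ofReal_gt hs) (inlW L g)).fst := rfl

/-- **The second component vanishes on real data at real `s`**: `(pairOpKC s (g, 0)).snd = 0`. [folklore] -/
theorem pairOpKC_inlW_snd (hL : 0 < L) (K : Esp L hL →L[ℝ] W L) (h : GardingDataKC L hL d V K D₀ D₁ V₀ c m) {s : ℝ} (hs : -m < s)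
    (g : W L) : (pairOpKC hL K h (s : ℂ) (re_ofReal_gt hs) (inlW L g)).snd = 0 := by
  refine eq_zero_of_weakK hL h.d_meas (shift_hypsKC h s).1 h.D₀_nonneg h.D₁_nonneg h.d_le (shift_hypsKC h s).2 K (kappaC_pos h hs)
    (coerciveKC_shift h s) fun v v₁ hv => ?_
  have e2 := ((pairOpKC_spec hL K h (s : ℂ) (re_ofReal_gt hs)).1 (inlW L g) v v₁ hv).2
  rw [Complex.ofReal_im, zero_mul, add_zero, (inlW_fst_snd g).2, integral_weight_zeroW hL] at e2
  simpa only [Complex.ofReal_re] using e2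

/-- **Weak meaning**: `u = prim (der (S g))` solves `linForm_{V+s}(u; v) + ∫ w (K S g) v = ∫ w g v` on every compactly supported test. [folklore] -/
theorem solOpKC_weak (hL : 0 < L) (K : Esp L hL →L[ℝ] W L) (h : GardingDataKC L hL d V K D₀ D₁ V₀ c m) {s : ℝ} (hs : -m < s) (g : W L)
    (v v₁ : ℝ → ℝ) (hv : IsCompactTest v v₁) :
    linForm L d (fun ξ => V ξ + s) (prim (der (solOpKC hL K h s hs g))) (der (solOpKC hL K h s hs g)) v v₁
      + ∫ y, (L ^ 2 + y ^ 2) * (((K (solOpKC hL K h s hs g) : W L) : ℝ → ℝ) y * v y) = ∫ y, (L ^ 2 + y ^ 2) * ((g : ℝ → ℝ) y * v y) := by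
  have e1 := ((pairOpKC_spec hL K h (s : ℂ) (re_ofReal_gt hs)).1 (inlW L g) v v₁ hv).1
  rw [Complex.ofReal_im, zero_mul, sub_zero, (inlW_fst_snd g).1] at e1
  simpa only [Complex.ofReal_re, solOpKC_apply] using e1

/-- **Uniqueness**: an energy-space weak solution of `(A + s)u = g` IS `S g`. [folklore] -/
theorem solOpKC_unique (hL : 0 < L) (K : Esp L hL →L[ℝ] W L) (h : GardingDataKC L hL d V K D₀ D₁ V₀ c m) {s : ℝ} (hs : -m < s) (g : W L)
    {p : Esp L hL}
    (hp : ∀ v v₁ : ℝ → ℝ, IsCompactTest v v₁ →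
      linForm L d (fun ξ => V ξ + s) (prim (der p)) (der p) v v₁ + ∫ y, (L ^ 2 + y ^ 2) * (((K p : W L) : ℝ → ℝ) y * v y) =
        ∫ y, (L ^ 2 + y ^ 2) * ((g : ℝ → ℝ) y * v y)) :
    p = solOpKC hL K h s hs g := by
  have hQ := pairOpKC_unique hL K h (s : ℂ) (re_ofReal_gt hs) (inlW L g) (Q := WithLp.toLp 2 (p, (0 : Esp L hL))) fun v v₁ hv => by
    have hf : (WithLp.toLp 2 (p, (0 : Esp L hL)) : WithLp 2 (Esp L hL × Esp L hL)).fst = p := rfl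
    have hsd : (WithLp.toLp 2 (p, (0 : Esp L hL)) : WithLp 2 (Esp L hL × Esp L hL)).snd = 0 := rfl
    rw [hf, hsd, (inlW_fst_snd g).1, (inlW_fst_snd g).2, Complex.ofReal_im, zero_mul, sub_zero, zero_mul, add_zero,
      integral_weight_zeroW hL]
    simp only [Complex.ofReal_re]
    exact ⟨hp v v₁ hv, scalar_lhs_zero hL K h s v v₁ hv⟩
  have := congrArg (fun Q : WithLp 2 (Esp L hL × Esp L hL) => Q.fst) hQ
  exact this

/-- **Energy bound** `‖S g‖_E ≤ (4/κ_c(s))‖g‖_w`, `κ_c(s) = min(c, 4(m + s))`. [folklore] -/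
theorem norm_solOpKC_le (hL : 0 < L) (K : Esp L hL →L[ℝ] W L) (h : GardingDataKC L hL d V K D₀ D₁ V₀ c m) {s : ℝ} (hs : -m < s)
    (g : W L) : ‖solOpKC hL K h s hs g‖ ≤ 4 / min c (4 * (m + s)) * ‖g‖ := by
  rw [solOpKC_apply]
  have hb := (pairOpKC_spec hL K h (s : ℂ) (re_ofReal_gt hs)).2 (inlW L g)
  rw [Complex.ofReal_re, norm_inlW] at hb
  exact (WithLp.norm_fst_le (x := pairOpKC hL K h (s : ℂ) (re_ofReal_gt hs) (inlW L g))).trans hb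

/-! ### §3 The place of `S_K(s)` in the complex resolvent, and the pivot bound -/

/-- **`R_K(s)(ofRealW g) = ofRealW (ιE (S g))`**: at real `s` and real data the complex resolvent is the real solution. [folklore] -/
theorem resolventKC_ofRealW (hL : 0 < L) (K : Esp L hL →L[ℝ] W L) (h : GardingDataKC L hL d V K D₀ D₁ V₀ c m) {s : ℝ} (hs : -m < s)
    (g : W L) : resolventKC hL K h (s : ℂ) (ofRealW L g) = ofRealW L (ιE hL (solOpKC hL K h s hs g)) := by
  obtain ⟨happ, -, -, -⟩ := resolventKC_weak hL K h (re_ofReal_gt hs) (ofRealW L g)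
  rw [happ, (ofPair_inlW g).2, ofPair_apply, (ιpair_fst_snd hL _).1, (ιpair_fst_snd hL _).2, pairOpKC_inlW_snd hL K h hs, map_zero,
    map_zero, smul_zero, add_zero, solOpKC_apply]

/-- **Pivot bound** `‖u‖_w = ‖ιE (S g)‖ ≤ ‖g‖_w/(m + s)` (from the sharp resolvent bound `‖R_K(σ)G‖ ≤ ‖G‖/(m + Re σ)`). [folklore] -/
theorem norm_ιE_solOpKC_le (hL : 0 < L) (K : Esp L hL →L[ℝ] W L) (h : GardingDataKC L hL d V K D₀ D₁ V₀ c m) {s : ℝ} (hs : -m < s)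
    (g : W L) : ‖ιE hL (solOpKC hL K h s hs g)‖ ≤ ‖g‖ / (m + s) := by
  have hb := norm_resolventKC_le_inv hL K h (re_ofReal_gt hs) (ofRealW L g)
  rw [resolventKC_ofRealW hL K h hs, Complex.ofReal_re] at hb
  have h1 : ‖ofRealW L (ιE hL (solOpKC hL K h s hs g))‖ = ‖ιE hL (solOpKC hL K h s hs g)‖ := by
    rw [← (ofPair_inlW _).1, norm_ofPair, norm_inlW]
  have h2 : ‖ofRealW L g‖ = ‖g‖ := by rw [← (ofPair_inlW g).1, norm_ofPair, norm_inlW]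
  rwa [h1, h2] at hb

end SheetRPerturbedSolutionOperator
end Summit.NavierStokesRegularity.OSWSelfSimilar

end
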